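import Summits.BirchSwinnertonDyer.Rank1Residual.X11b.IntSeriesValueRigidityOneSided
import Summits.BirchSwinnertonDyer.Rank1Residual.X2.OpenDiscSeriesContinuity
import Summits.BirchSwinnertonDyer.Rank1Residual.X2.NonsplitBDPValueDisplayRescale
import HarnessLib

/-!
# Route `BiquadraticEisensteinDescent` (W-ALL row 12 · K12i), crux (W♭) `KatzWaldspurgerFrameCMInertBadFlat`
# (stmt-BirchSwinnertonDyer-20453): ONE-SIDED ♭-V1RIG AT `c = 0` — a Λ-adic frame `Q' ∈ 𝓞_{ℂ_p}⟦T⟧` against an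
# EXACT display `𝓛(χ)·C⁻¹·r(σ)^{−a}` whose Amice function `𝓛` VANISHES at `𝟙` has `[T⁰]Q' = 0`

Helper for crux item stmt-BirchSwinnertonDyer-20453 (W♭), prover seat bsd-wall-bed-p2 (g2), 2026-08-27. THEOREMS ONLY
(elementary `p`-adic analysis; 0 definitions, 0 named facts, 0 sorry); nothing here closes W♭ by itself.

## Why

The X11b kernel transfers a value theorem in continuous-function currency to every ♭-frame ONLY when the limit
`c ≠ 0` (`X11b.intSeries_constantCoeff_eq_of_isBDPLFunctionInt_of_continuousValues`, whose docstring records «the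
case `c = 0` is not covered one-sidedly»). For W♭ the limit is `u·(log_{ω_E} P)²`, which vanishes exactly when the
Heegner point `P` is TORSION — a case the crux's binders do not exclude (they would, granted Gross–Zagier; W♭ carries
no such antecedent). At `c = 0` the bare limit is indeed not enough, but the LZZ road delivers MORE than a limit: an
EXACT per-character display `𝓛(χ)·C⁻¹·r(σ𝔭)^{−a}` with `𝓛` a power series on the open disc
(`…LZZRoad.exists_exactDisplay_of_thm151_thm153_additive`). With that structure the torsion case closes too:

* §1 **`intSeries_constantCoeff_eq_zero_of_values_order`** (abstract core at `c = 0`): along `T_k → 0` let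
  `Q'` take the values `a_k·T_k^d·v_k` at `T_k` and `a_k²·(T_k(T_k+2))^d·w_k` at `T_k(T_k+2)`, with `d ≥ 1` and
  `v_k, w_k → c ≠ 0`. Then `[T⁰]Q' = 0`: otherwise the ORDER LEMMA (`X11b.intSeries_norm_value_eq_of_order` at order
  `0`) gives `‖a_k‖‖T_k‖^d‖c‖ = ‖[T⁰]Q'‖ = ‖a_k‖²‖T_k‖^d‖2‖^d‖c‖` for large `k`, whence `‖a_k‖·‖2‖^d = 1` and
  `‖[T⁰]Q'‖ = ‖T_k‖^d‖c‖/‖2‖^d → 0`, absurd.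
* §2 **`intSeries_constantCoeff_eq_zero_of_isBDPLFunctionInt_of_exactDisplay`** (BDP form, supply discharged: odd
  `p`, `K` imaginary quadratic, `κ` anticyclotomic, `κ.IsTopGenerator γ`): a ♭-frame `(Ω_K', Ω_p', Q')` and virtual
  periods `(Ω_K, Ω_p)` whose display is EXACTLY `𝓛(χ)·C⁻¹·r(σ)^{−a}` at every character of the range, with `𝓛(x) =
  ∑ a_m x^m` bounded on closed sub-discs and `a₀ = 0` ⟹ `[T⁰]Q' = 0`. (Frame rescale `X11b.intSeries_hasValueAt_frame_rescale`,
  supply `X11b.exists_interpolationSupply_pow`, uniform avatar convergence `X2.PNewDisplay.eventually_forall_norm_avatarValueAt_sub_one_lt`,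
  open-disc continuity `X2.tendsto_value_of_tendsto_zero_of_coeff_bound`; if `𝓛 ≡ 0` the frame's values vanish along the
  supply and so does `[T⁰]Q'`; else `𝓛 = T^d·h`, `d ≥ 1`, `h(0) ≠ 0`, and §1 applies.)

References: [Castella2018] Thms. 3.1–3.2 (arXiv:1704.06608 pp. 8–9) (the frames); [Cassels1986] Ch. 4 Lemma 2.1 (the
order lemma); [Washington1997] §7.1 (power series on the open unit disc).
-/

set_option autoImplicit false

-- D-0017 layout: summit = sub-problem, so `Summit.BirchSwinnertonDyer.BirchSwinnertonDyer.…` is the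
-- mandated namespace of Theorems files (same option as the route's sibling Theorems files).
set_option linter.dupNamespace false

noncomputable section

open scoped Classical Topology NumberField

namespace Summit.BirchSwinnertonDyer.BirchSwinnertonDyer.Theorems.BiquadraticEisensteinDescentKatzWaldspurgerFrameCMInertBadFlatZeroRigidity

open Filter NumberField IsDedekindDomain Field PowerSeries
  Literature.NumberTheory.EllipticCurves Literature.NumberTheory.GaloisRepresentations
  Summit.BirchSwinnertonDyer.Rank1Residual Summit.BirchSwinnertonDyer.Rank1Residual.X11b
  Summit.BirchSwinnertonDyer.Rank1Residual.X11b.Halves Summit.BirchSwinnertonDyer.Rank1Residual.X2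

variable {p : ℕ} [Fact p.Prime]

/-! ### §1 The abstract core at `c = 0` -/

/-- **One-sided ♭-V1RIG core at `c = 0`.** Along `T_k → 0` let `Q' ∈ 𝓞_{ℂ_p}⟦T⟧` take the values
`a_k·T_k^d·v_k` at `T_k` and `a_k²·(T_k(T_k + 2))^d·w_k` at `T_k(T_k + 2)`, with `d ≥ 1` and `v_k, w_k → c ≠ 0`.
Then `[T⁰]Q' = 0` (module docstring §1: the order lemma at order `0` forces `‖a_k‖‖2‖^d = 1` and then
`‖[T⁰]Q'‖ = ‖T_k‖^d‖c‖/‖2‖^d`, which is eventually smaller than itself). [folklore] -/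
theorem intSeries_constantCoeff_eq_zero_of_values_order {Q' : PowerSeries 𝓞_ℂ_[p]}
    {T v w a : ℕ → ℂ_[p]} {c : ℂ_[p]} {d : ℕ} (hT0 : Tendsto T atTop (𝓝 0)) (hd : 0 < d)
    (hv_lim : Tendsto v atTop (𝓝 c)) (hw_lim : Tendsto w atTop (𝓝 c)) (hc0 : c ≠ 0)
    (hv' : ∀ k, IntSeries.HasValueAt Q' (T k) (a k * T k ^ d * v k))
    (hw' : ∀ k, IntSeries.HasValueAt Q' (T k * (T k + 2)) (a k ^ 2 * (T k * (T k + 2)) ^ d * w k)) :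
    constantCoeff Q' = 0 := by
  by_contra hq
  set q : ℂ_[p] := ((constantCoeff Q' : 𝓞_ℂ_[p]) : ℂ_[p]) with hqdef
  have hq0 : q ≠ 0 := by rw [hqdef, Ne, ZeroMemClass.coe_eq_zero]; exact hq
  have hqpos : 0 < ‖q‖ := norm_pos_iff.mpr hq0
  have hcpos : 0 < ‖c‖ := norm_pos_iff.mpr hc0
  -- order `0`: the coefficient at the order is `[T⁰]Q'`
  have hQ'ne : Q' ≠ 0 := fun h0 ↦ hq (by rw [h0, map_zero])
  have hord : Q'.order.toNat = 0 := by
    have h : Q'.order = 0 := by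
      rw [← Nat.cast_zero, order_eq_nat]
      exact ⟨by rwa [coeff_zero_eq_constantCoeff], fun i hi ↦ absurd hi (Nat.not_lt_zero i)⟩
    rw [h]; rfl
  have hcoeff : ((coeff 0 Q' : 𝓞_ℂ_[p]) : ℂ_[p]) = q := by
    rw [coeff_zero_eq_constantCoeff]
  -- eventual statements
  have hT2 : Tendsto (fun k ↦ T k + 2) atTop (𝓝 2) := by simpa using hT0.add_const 2
  have hT'0 : Tendsto (fun k ↦ T k * (T k + 2)) atTop (𝓝 0) := by simpa using hT0.mul hT2
  have hTn : Tendsto (fun k ↦ ‖T k‖) atTop (𝓝 0) := tendsto_zero_iff_norm_tendsto_zero.mp hT0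
  have hT'n : Tendsto (fun k ↦ ‖T k * (T k + 2)‖) atTop (𝓝 0) :=
    tendsto_zero_iff_norm_tendsto_zero.mp hT'0
  have hTdn : Tendsto (fun k ↦ ‖T k‖ ^ d) atTop (𝓝 0) := by
    simpa [zero_pow hd.ne'] using hTn.pow d
  have h2pos : 0 < ‖(2 : ℂ_[p])‖ := norm_pos_iff.mpr two_ne_zero
  have h2d : 0 < ‖(2 : ℂ_[p])‖ ^ d := pow_pos h2pos d
  have E1 : ∀ᶠ k in atTop, ‖T k‖ < 1 := hTn.eventually_lt_const zero_lt_one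
  have E2 : ∀ᶠ k in atTop, ‖T k‖ < ‖q‖ := hTn.eventually_lt_const hqpos
  have E3 : ∀ᶠ k in atTop, ‖T k * (T k + 2)‖ < 1 := hT'n.eventually_lt_const zero_lt_one
  have E4 : ∀ᶠ k in atTop, ‖T k * (T k + 2)‖ < ‖q‖ := hT'n.eventually_lt_const hqpos
  have E5 : ∀ᶠ k in atTop, ‖v k‖ = ‖c‖ := eventually_norm_eq_of_tendsto hc0 hv_lim
  have E6 : ∀ᶠ k in atTop, ‖w k‖ = ‖c‖ := eventually_norm_eq_of_tendsto hc0 hw_lim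
  have E7 : ∀ᶠ k in atTop, ‖T k + 2‖ = ‖(2 : ℂ_[p])‖ := eventually_norm_eq_of_tendsto two_ne_zero hT2
  have E8 : ∀ᶠ k in atTop, ‖T k‖ ^ d < ‖q‖ * ‖(2 : ℂ_[p])‖ ^ d / ‖c‖ :=
    hTdn.eventually_lt_const (div_pos (mul_pos hqpos h2d) hcpos)
  obtain ⟨k, h1, h2, h3, h4, h5, h6, h7, h8⟩ :=
    (E1.and (E2.and (E3.and (E4.and (E5.and (E6.and (E7.and E8))))))).exists
  -- the order lemma at the two points
  have hA : ‖a k‖ * ‖T k‖ ^ d * ‖c‖ = ‖q‖ := by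
    have h := intSeries_norm_value_eq_of_order h1 (by rw [hord, hcoeff]; exact h2) (hv' k)
    rw [hord, pow_zero, one_mul, hcoeff, norm_mul, norm_mul, norm_pow, h5] at h
    exact h
  have hB : ‖a k‖ ^ 2 * (‖T k‖ ^ d * ‖(2 : ℂ_[p])‖ ^ d) * ‖c‖ = ‖q‖ := by
    have h := intSeries_norm_value_eq_of_order h3 (by rw [hord, hcoeff]; exact h4) (hw' k)
    rw [hord, pow_zero, one_mul, hcoeff, norm_mul, norm_mul, norm_pow, norm_pow, norm_mul, h6, h7,
      mul_pow] at h
    exact h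
  -- `‖a_k‖·‖2‖^d = 1`
  have hX0 : ‖a k‖ * ‖T k‖ ^ d * ‖c‖ ≠ 0 := by rw [hA]; exact hqpos.ne'
  have hak : ‖a k‖ * ‖(2 : ℂ_[p])‖ ^ d = 1 := by
    have h : ‖a k‖ * ‖(2 : ℂ_[p])‖ ^ d * (‖a k‖ * ‖T k‖ ^ d * ‖c‖) =
        1 * (‖a k‖ * ‖T k‖ ^ d * ‖c‖) := by
      rw [one_mul]
      calc ‖a k‖ * ‖(2 : ℂ_[p])‖ ^ d * (‖a k‖ * ‖T k‖ ^ d * ‖c‖)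
          = ‖a k‖ ^ 2 * (‖T k‖ ^ d * ‖(2 : ℂ_[p])‖ ^ d) * ‖c‖ := by ring
        _ = ‖q‖ := hB
        _ = ‖a k‖ * ‖T k‖ ^ d * ‖c‖ := hA.symm
    exact mul_right_cancel₀ hX0 h
  -- `‖T_k‖^d = ‖q‖‖2‖^d/‖c‖`, contradicting `E8`
  have hTd : ‖T k‖ ^ d = ‖q‖ * ‖(2 : ℂ_[p])‖ ^ d / ‖c‖ := by
    rw [eq_div_iff hcpos.ne', ← hA]
    calc ‖T k‖ ^ d * ‖c‖ = (‖a k‖ * ‖(2 : ℂ_[p])‖ ^ d) * ‖T k‖ ^ d * ‖c‖ := by rw [hak, one_mul]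
      _ = ‖a k‖ * ‖T k‖ ^ d * ‖c‖ * ‖(2 : ℂ_[p])‖ ^ d := by ring
  exact (lt_irrefl _) (hTd ▸ h8)

/-! ### §2 The BDP form against an EXACT display with `𝓛(𝟙) = 0` (supply discharged) -/

section BDP

variable {K : Type} [Field K] [NumberField K] {N : ℕ}

/-- From `HasSum (a_m x^m) L` with `a_m = 0` for `m < d` and `x ≠ 0`: the shifted series has the value
`L / x^d`. [folklore] -/
theorem hasSum_shift_of_coeff_zero {a : ℕ → ℂ_[p]} {d : ℕ} (hz : ∀ m < d, a m = 0) {x L : ℂ_[p]}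
    (hx : x ≠ 0) (hL : HasSum (fun m ↦ a m * x ^ m) L) :
    HasSum (fun j ↦ a (j + d) * x ^ j) (L / x ^ d) := by
  have hxd : x ^ d ≠ 0 := pow_ne_zero _ hx
  have h1 : HasSum (fun j ↦ a (j + d) * x ^ (j + d)) L := by
    have h := (hasSum_nat_add_iff' d).mpr hL
    have hsum : ∑ i ∈ Finset.range d, a i * x ^ i = 0 :=
      Finset.sum_eq_zero fun i hi ↦ by rw [hz i (Finset.mem_range.mp hi), zero_mul]
    rwa [hsum, sub_zero] at h
  have h2 := h1.mul_left (x ^ d)⁻¹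
  have h3 : (fun j ↦ (x ^ d)⁻¹ * (a (j + d) * x ^ (j + d))) = fun j ↦ a (j + d) * x ^ j := by
    funext j
    rw [pow_add]
    field_simp
  rw [h3, inv_mul_eq_div] at h2
  exact h2

/-- **One-sided ♭-V1RIG at `c = 0`, BDP form, supply discharged.** For odd `p`, `K` imaginary quadratic, `κ`
anticyclotomic with topological generator `γ`: let `(Ω_K', Ω_p', Q')` be a ♭-frame (`Ω_K' ≠ 0`) and `(Ω_K, Ω_p)`
non-zero virtual periods whose display is EXACTLY `𝓛(χ_φ)·C⁻¹·r(σ)^{−a}` at every unramified `φ` of type `(n,−n)`,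
`n ≥ 1`, with avatar `r` through `κ` — `𝓛(x) = ∑ a_m x^m` with `‖a_m‖ρ^m` bounded for every `0 < ρ < 1`,
`C ≠ 0` — and suppose `a₀ = 𝓛(𝟙) = 0`. Then `[T⁰]Q' = 0`. (Module docstring §2.)
[cite: Castella2018, Thm. 3.1–3.2 (arXiv:1704.06608 pp. 8–9)] [cite: Washington1997, §7.1] -/
theorem intSeries_constantCoeff_eq_zero_of_isBDPLFunctionInt_of_exactDisplay (hp2 : p ≠ 2)
    {ι : PadicAlgCl p ≃+* ℂ} {𝔭 : HeightOneSpectrum (𝓞 K)} {κ : ZpExtension K p}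
    {γ σ : Field.absoluteGaloisGroup K} {f : CuspForm (CongruenceSubgroup.Gamma0 N) 2}
    {ΩK ΩK' : ℂ} {Ωp Ωp' : ℂ_[p]} {Q' : PowerSeries 𝓞_ℂ_[p]} {a : ℕ → ℂ_[p]} {C : ℂ_[p]} {aN : ℕ}
    (hK : IsImaginaryQuadratic K) (hκ : κ.IsAnticyclotomic) (hγ : κ.IsTopGenerator γ)
    (hΩK : ΩK ≠ 0) (hΩK' : ΩK' ≠ 0) (hΩp : Ωp ≠ 0)
    (hrad : ∀ ρ : ℝ, 0 < ρ → ρ < 1 → ∃ B : ℝ, ∀ m : ℕ, ‖a m‖ * ρ ^ m ≤ B) (ha0 : a 0 = 0) (hC : C ≠ 0)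
    (hdisp : ∀ (φ : HeckeCharacter K) (n : ℕ) (r : FramedGaloisRep K (PadicAlgCl p) 1), 0 < n →
      (∀ v : HeightOneSpectrum (𝓞 K), φ.IsUnramifiedAt v) →
      φ.HasInfinityType (fun _ ↦ (n : ℤ)) (fun _ ↦ -(n : ℤ)) →
      IsPAdicAvatarOf ι φ r → FactorsThroughZp κ r →
      ∃ L : ℂ_[p], HasSum (fun m : ℕ ↦ a m * (avatarValueAt r γ - 1) ^ m) L ∧
        ((ι.symm (bdpInterpolationValue p f 𝔭 φ n ΩK) : PadicAlgCl p) : ℂ_[p]) * Ωp ^ (4 * n) =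
          L * C⁻¹ * (avatarValueAt r σ ^ aN)⁻¹)
    (hQ' : R1.IsBDPLFunctionInt p ι 𝔭 κ γ f ΩK' Ωp' Q') :
    constantCoeff Q' = 0 := by
  have hp : p.Prime := Fact.out
  obtain ⟨m, x₀, φ, φ', r, r', hm, hx1, hx, hunr, hinf, hr, hrκ, hval, hunr', hinf', hr', hrκ', hval'⟩ :=
    exists_interpolationSupply_pow hp2 ι K κ hK hκ γ hγ
  set T : ℕ → ℂ_[p] := fun k ↦ x₀ ^ p ^ k - 1 with hT
  have hT0 : Tendsto T atTop (𝓝 0) := by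
    have h := hx.sub_const 1
    rwa [sub_self] at h
  have hTne : ∀ k, T k ≠ 0 := fun k h0 ↦ hx1 k (sub_eq_zero.mp h0)
  have hT' : ∀ k, x₀ ^ (2 * p ^ k) - 1 = T k * (T k + 2) := by
    intro k
    simp only [hT]
    ring
  have hn : ∀ k, 0 < m * p ^ k := fun k ↦ Nat.mul_pos hm (pow_pos hp.pos k)
  have hn' : ∀ k, 0 < 2 * m * p ^ k := fun k ↦ Nat.mul_pos (Nat.mul_pos two_pos hm) (pow_pos hp.pos k)
  -- the period ratio
  set β : ℂ_[p] := ((ι.symm ((ΩK / ΩK') ^ 4) : PadicAlgCl p) : ℂ_[p]) * (Ωp' / Ωp) ^ 4 with hβ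
  set b : ℕ → ℂ_[p] := fun k ↦ β ^ (m * p ^ k) with hb
  -- the exact display along the two families
  choose L hL hD using fun k ↦ hdisp (φ k) (m * p ^ k) (r k) (hn k) (hunr k) (hinf k) (hr k) (hrκ k)
  choose L' hL' hD' using fun k ↦ hdisp (φ' k) (2 * m * p ^ k) (r' k) (hn' k) (hunr' k) (hinf' k) (hr' k)
    (hrκ' k)
  -- the frame's values at `T_k` and `T_k (T_k + 2)`
  have hQ'v : ∀ k, IntSeries.HasValueAt Q' (T k)
      (b k * (L k * C⁻¹ * (avatarValueAt (r k) σ ^ aN)⁻¹)) := by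
    intro k
    have h := intSeries_hasValueAt_frame_rescale hΩK hΩK' hΩp hQ' (hn k) (hunr k) (hinf k) (hr k) (hrκ k)
    rw [hval k, hD k] at h
    convert h using 1
    simp only [hb, hβ]
    ring
  have hQ'w : ∀ k, IntSeries.HasValueAt Q' (T k * (T k + 2))
      (b k ^ 2 * (L' k * C⁻¹ * (avatarValueAt (r' k) σ ^ aN)⁻¹)) := by
    intro k
    have h := intSeries_hasValueAt_frame_rescale hΩK hΩK' hΩp hQ' (hn' k) (hunr' k) (hinf' k) (hr' k)
      (hrκ' k)
    rw [hval' k, hT' k, hD' k] at h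
    convert h using 1
    simp only [hb, hβ]
    ring
  -- the avatars at `σ` tend to `1` along both families
  have hlimγ : Tendsto (fun k ↦ avatarValueAt (r k) γ) atTop (𝓝 1) := by simp_rw [hval]; exact hx
  have hlimγ' : Tendsto (fun k ↦ avatarValueAt (r' k) γ) atTop (𝓝 1) := by
    simp_rw [hval']
    have h2 : Tendsto (fun k ↦ (x₀ ^ p ^ k) ^ 2) atTop (𝓝 1) := by simpa using hx.pow 2
    refine h2.congr fun k ↦ ?_
    ring
  have hσ : Tendsto (fun k ↦ avatarValueAt (r k) σ) atTop (𝓝 1) := by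
    rw [Metric.tendsto_nhds]
    intro ε hε
    filter_upwards [PNewDisplay.eventually_forall_norm_avatarValueAt_sub_one_lt hγ hrκ hlimγ hε] with k hk
    rw [dist_eq_norm]
    exact hk σ
  have hσ' : Tendsto (fun k ↦ avatarValueAt (r' k) σ) atTop (𝓝 1) := by
    rw [Metric.tendsto_nhds]
    intro ε hε
    filter_upwards [PNewDisplay.eventually_forall_norm_avatarValueAt_sub_one_lt hγ hrκ' hlimγ' hε] with k hk
    rw [dist_eq_norm]
    exact hk σ
  have hE : Tendsto (fun k ↦ C⁻¹ * (avatarValueAt (r k) σ ^ aN)⁻¹) atTop (𝓝 (C⁻¹ * 1)) := by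
    have h := ((hσ.pow aN).inv₀ (by simp)).const_mul C⁻¹
    simpa using h
  have hE' : Tendsto (fun k ↦ C⁻¹ * (avatarValueAt (r' k) σ ^ aN)⁻¹) atTop (𝓝 (C⁻¹ * 1)) := by
    have h := ((hσ'.pow aN).inv₀ (by simp)).const_mul C⁻¹
    simpa using h
  -- the points `T_k (T_k + 2)` tend to `0`
  have hT2 : Tendsto (fun k ↦ T k + 2) atTop (𝓝 2) := by simpa using hT0.add_const 2
  have hT'0 : Tendsto (fun k ↦ T k * (T k + 2)) atTop (𝓝 0) := by simpa using hT0.mul hT2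
  have hxT' : ∀ k, avatarValueAt (r' k) γ - 1 = T k * (T k + 2) := fun k ↦ by rw [hval' k, hT' k]
  have hxT : ∀ k, avatarValueAt (r k) γ - 1 = T k := fun k ↦ by rw [hval k]
  by_cases hall : ∀ j, a j = 0
  · -- `𝓛 ≡ 0`: the frame's values vanish along the supply, hence so does `[T⁰]Q'`
    have hL0 : ∀ k, L k = 0 := fun k ↦ by
      have h := hL k
      simp_rw [hall, zero_mul] at h
      exact h.unique hasSum_zero ▸ rfl
    have hvals : ∀ k, IntSeries.HasValueAt Q' (T k) 0 := fun k ↦ by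
      have h := hQ'v k
      rwa [hL0 k, zero_mul, zero_mul, mul_zero] at h
    have hlim := intSeries_tendsto_value_of_tendsto_zero hT0 hvals
    have h0 : ((constantCoeff Q' : 𝓞_ℂ_[p]) : ℂ_[p]) = 0 :=
      (tendsto_nhds_unique hlim tendsto_const_nhds).symm ▸ rfl
    exact (ZeroMemClass.coe_eq_zero).mp h0
  · -- `𝓛 = T^d · h` with `d ≥ 1`, `h(0) = a_d ≠ 0`
    push Not at hall
    set G : PowerSeries ℂ_[p] := PowerSeries.mk a with hG
    have hGne : G ≠ 0 := by
      obtain ⟨j, hj⟩ := hall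
      intro h0
      apply hj
      have := congrArg (coeff j) h0
      rwa [hG, coeff_mk, map_zero] at this
    set d : ℕ := G.order.toNat with hddef
    have hordfin : G.order ≠ ⊤ := fun h ↦ hGne (order_eq_top.mp h)
    have hordd : G.order = (d : ℕ∞) := (ENat.coe_toNat hordfin).symm
    have had : a d ≠ 0 := by
      have h := coeff_order hGne
      rwa [← hddef, hG, coeff_mk] at h
    have hz : ∀ j < d, a j = 0 := fun j hj ↦ by
      have h := coeff_of_lt_order j (by rw [hordd]; exact_mod_cast hj : (j : ℕ∞) < G.order)
      rwa [hG, coeff_mk] at h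
    have hd : 0 < d := by
      rcases Nat.eq_zero_or_pos d with h | h
      · exact absurd (h ▸ ha0) had
      · exact h
    -- the shifted coefficients and their bound
    obtain ⟨B, hB⟩ := hrad (1 / 2) (by norm_num) (by norm_num)
    have hB' : ∀ j, ‖a (j + d)‖ * (1 / 2 : ℝ) ^ j ≤ B * 2 ^ d := by
      intro j
      have h := hB (j + d)
      have h2 : (0 : ℝ) < (1 / 2 : ℝ) ^ d := by positivity
      calc ‖a (j + d)‖ * (1 / 2 : ℝ) ^ j = ‖a (j + d)‖ * (1 / 2 : ℝ) ^ (j + d) / (1 / 2 : ℝ) ^ d := by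
            rw [pow_add, ← mul_assoc, mul_div_cancel_right₀ _ h2.ne']
        _ ≤ B / (1 / 2 : ℝ) ^ d := div_le_div_of_nonneg_right h h2.le
        _ = B * 2 ^ d := by rw [one_div, inv_pow, div_inv_eq_mul]
    -- the shifted values `h(T_k) = L_k / T_k^d → a_d`
    have hH : ∀ k, HasSum (fun j ↦ a (j + d) * T k ^ j) (L k / T k ^ d) := fun k ↦ by
      have h := hL k
      rw [hxT k] at h
      exact hasSum_shift_of_coeff_zero hz (hTne k) h
    have hHlim : Tendsto (fun k ↦ L k / T k ^ d) atTop (𝓝 (a (0 + d))) :=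
      tendsto_value_of_tendsto_zero_of_coeff_bound (ρ := 1 / 2) (by norm_num) hB' hT0 hH
    rw [zero_add] at hHlim
    -- the primed family: either some `T_k (T_k + 2)` vanishes (then `Q'(0) = 0` directly), or shift as well
    by_cases hzero : ∃ k, T k * (T k + 2) = 0
    · obtain ⟨k, hk⟩ := hzero
      have hL'0 : L' k = 0 := by
        have h := hL' k
        rw [hxT' k, hk] at h
        have h' : HasSum (fun j : ℕ ↦ a j * (0 : ℂ_[p]) ^ j) (a 0) := by
          have := hasSum_single (f := fun j : ℕ ↦ a j * (0 : ℂ_[p]) ^ j) 0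
            (fun j hj ↦ by rw [zero_pow hj, mul_zero])
          simpa using this
        rw [h.unique h', ha0]
      have h := hQ'w k
      rw [hk, hL'0, zero_mul, zero_mul, mul_zero] at h
      have h0 := h.unique (R1.intSeries_hasValueAt_zero p Q')
      exact (ZeroMemClass.coe_eq_zero).mp h0.symm
    · push Not at hzero
      have hH' : ∀ k, HasSum (fun j ↦ a (j + d) * (T k * (T k + 2)) ^ j)
          (L' k / (T k * (T k + 2)) ^ d) := fun k ↦ by
        have h := hL' k
        rw [hxT' k] at h
        exact hasSum_shift_of_coeff_zero hz (hzero k) h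
      have hH'lim : Tendsto (fun k ↦ L' k / (T k * (T k + 2)) ^ d) atTop (𝓝 (a (0 + d))) :=
        tendsto_value_of_tendsto_zero_of_coeff_bound (ρ := 1 / 2) (by norm_num) hB' hT'0 hH'
      rw [zero_add] at hH'lim
      -- apply the core with `v_k = h(T_k)·C⁻¹·r_k(σ)^{−a}`, `w_k` likewise
      have hc0 : a d * (C⁻¹ * 1) ≠ 0 := mul_ne_zero had (by simpa using inv_ne_zero hC)
      refine intSeries_constantCoeff_eq_zero_of_values_order (a := b) hT0 hd (hHlim.mul hE) (hH'lim.mul hE')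
        hc0 (fun k ↦ ?_) (fun k ↦ ?_)
      · have hTd : T k ^ d ≠ 0 := pow_ne_zero _ (hTne k)
        have heq : b k * T k ^ d * (L k / T k ^ d * (C⁻¹ * (avatarValueAt (r k) σ ^ aN)⁻¹)) =
            b k * (L k * C⁻¹ * (avatarValueAt (r k) σ ^ aN)⁻¹) := by
          field_simp
        rw [heq]
        exact hQ'v k
      · have hTd : (T k * (T k + 2)) ^ d ≠ 0 := pow_ne_zero _ (hzero k)
        have heq : b k ^ 2 * (T k * (T k + 2)) ^ d *
            (L' k / (T k * (T k + 2)) ^ d * (C⁻¹ * (avatarValueAt (r' k) σ ^ aN)⁻¹)) =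
            b k ^ 2 * (L' k * C⁻¹ * (avatarValueAt (r' k) σ ^ aN)⁻¹) := by
          field_simp
        rw [heq]
        exact hQ'w k

end BDP

end Summit.BirchSwinnertonDyer.BirchSwinnertonDyer.Theorems.BiquadraticEisensteinDescentKatzWaldspurgerFrameCMInertBadFlatZeroRigidity

end
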